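import Summits.Langlands.Langlands.Theses.PrimeSwitchSplit
import HarnessLib

/-!
# BC3 birth skeleton — `PrimeSwitchSplit.CompatibilityAwayFromLR` (stmt-Langlands-18084), BY NAME
(registered from the crux-strategist seat `cstrat-stmt-Langlands-18745-r1`, 2026-08-17: L∤R is child 4 of the BC2-redirect split of
`DyadicOddResidue.SectorComplement`, VERBATIM this item, and (d) of the certificate wants a registered plan on every open piece)

L∤R = Taylor 2004 Conj. 7 at the places `v ∤ ℓ`, `∀ Rec` form: for irreducible pinned-geometric `ρ` Satake–Frobenius compatible a.e.
with an L-algebraic cuspidal `π`, `LocalGlobalCompatibleAt Rec ι π ρ v` at every finite `v ∤ ℓ`.  Cut along the one honest seam of the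
statement — the place `v` is, or is not, a Satake–Frobenius-compatible place of the pair:

* `stub_satakePlaces` — at a place `v ∤ ℓ` where the pair IS Satake–Frobenius compatible (`π` unramified at `v` with parameter `α`,
  `ρ` unramified at `v` with `charpoly ρ(Frob_v) = ∏ (X − ι⁻¹(α_j⁻¹))`), local–global compatibility holds: the local component of `π`
  at `v` is the unramified constituent with Satake parameter `α` (local new-vector theory), `rec_v` of an unramified generic class is the
  unramified parameter with the same eigenvalues (`IsLocalLanglandsGL`: `gl_one` + compatibility with parabolic induction, Henniart
  normalisation), and the Grothendieck–Deligne Weil–Deligne representation of an unramified `ρ|_(Γ_(K_v))` is `(Frob ↦ ρ(Frob), N = 0)`;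
  KNOWN, a formalisation debt of size L against the typed interfaces (`HasLocalComponentAt`, `IsWeilDeligneOfLadic`, `recGL`).
* `stub_exceptionalPlaces` — at the finitely many `v ∤ ℓ` where the pair is NOT Satake–Frobenius compatible (ramified `π_v` or `ρ_v`):
  the OPEN CORE (Carayol 1986 for Hilbert modular forms; Harris–Taylor / Taylor–Yoshida / Shin / Caraiani 2012 for polarizable regular `π`
  over CM fields; Varma 2024 up to Frobenius-semisimplification-and-N for non-polarizable regular `π`; nothing for irregular `π` or
  general `K`), and `∀ Rec` exposes Henniart-sharpness of the typed `IsLocalLanglandsGL`.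

Neither stub is the item (each misses a typed set of places), neither gives the summit (no (B), no avatars, no `v ∣ ℓ`) — stub probes in
`bc/stubprobe_LR_*.lean` of the seat folder.  Shape: 2 NAMED stubs (the ONLY sorries) and the kernel-checked composition
`CompatibilityAwayFromLR_of : <stub₁-sig> → <stub₂-sig> → CompatibilityAwayFromLR` concluding the ROUTE DECL
`Summit.Langlands.Langlands.Theses.PrimeSwitchSplit.CompatibilityAwayFromLR` by name (hypotheses = the `_Goal.stub_*` mirrors, registered-skeleton shape; by-name sanity `example`).
-/

noncomputable section

set_option linter.dupNamespace false

namespace Summit.Langlands.Langlands.Cruxes.SectorComplement.BirthCompatibilityAwayFromLR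

open scoped NumberField Classical Topology
open Filter IsDedekindDomain
open Literature.NumberTheory.Automorphic Literature.NumberTheory.GaloisRepresentations
open Summit.Langlands

open Summit.Langlands.Langlands.Theses.PrimeSwitchSplit (CompatibilityAwayFromLR)

/-- **stub 1 — local–global compatibility at the Satake–Frobenius-compatible places away from `ℓ` (KNOWN; formalisation debt L)**:
see the module docstring.  Why it might fail: only through a gap in the typed local interfaces (e.g. `IsLocalLanglandsGL` not pinning
`rec_v` on unramified generic classes to the Satake parameter — it does, via `gl_one`, twists and `L`-factors of pairs against characters).
[cite: BuzzardGeeLMS2014, Conj. 3.2.1 and Rem. 3.2.5] [cite: HarrisTaylorAMS2001, Thm. A] [cite: TateCorvallis1979, (4.2.1)] -/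
theorem stub_satakePlaces :
    ∀ (K : Type) [Field K] [NumberField K] (Rec : ReciprocityData K) (n : ℕ) (hcpt : Literature.NumberTheory.Automorphic.isCompact_glFiniteIntegralLevel n K), 0 < n → ∀ (π : Literature.NumberTheory.Automorphic.CuspidalAutomorphicRepData n K hcpt), π.1.IsLAlgebraic → ∀ (ℓ : ℕ) [Fact ℓ.Prime] (ι : PadicAlgCl ℓ ≃+* ℂ) (ρ : Literature.NumberTheory.GaloisRepresentations.FramedGaloisRep K (PadicAlgCl ℓ) n), ρ.toGaloisRep.IsIrreducible → ((∀ᶠ v : IsDedekindDomain.HeightOneSpectrum (NumberField.RingOfIntegers K) in cofinite, ρ.IsUnramifiedAt v) ∧ ∀ (v : IsDedekindDomain.HeightOneSpectrum (NumberField.RingOfIntegers K)) (hv : ((ℓ : ℕ) : NumberField.RingOfIntegers K) ∈ v.asIdeal), (Literature.NumberTheory.PAdicHodge.fontainePstAdicCompletion v ℓ hv).IsDeRhamFramed (ρ.toLocal v)) → (∀ᶠ v : IsDedekindDomain.HeightOneSpectrum (NumberField.RingOfIntegers K) in cofinite, SatakeFrobCompatibleAt ι π.1 ρ v) → ∀ v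 : IsDedekindDomain.HeightOneSpectrum (NumberField.RingOfIntegers K), ((ℓ : ℕ) : NumberField.RingOfIntegers K) ∉ v.asIdeal → SatakeFrobCompatibleAt ι π.1 ρ v → LocalGlobalCompatibleAt Rec ι π.1 ρ v := by
  sorry

/-- **stub 2 — local–global compatibility at the exceptional places away from `ℓ` (OPEN CORE)**: see the module docstring.
[cite: TaylorGaloisRepresentations2004, Conj. 7] [cite: CarayolASENS1986, Thm.] [cite: Caraiani2012, Thm. 1.1] [cite: VarmaFMS2024, Thm. 1] -/
theorem stub_exceptionalPlaces :
    ∀ (K : Type) [Field K] [NumberField K] (Rec : ReciprocityData K) (n : ℕ) (hcpt : Literature.NumberTheory.Automorphic.isCompact_glFiniteIntegralLevel n K), 0 < n → ∀ (π : Literature.NumberTheory.Automorphic.CuspidalAutomorphicRepData n K hcpt), π.1.IsLAlgebraic → ∀ (ℓ : ℕ) [Fact ℓ.Prime] (ι : PadicAlgCl ℓ ≃+* ℂ) (ρ : Literature.NumberTheory.GaloisRepresentations.FramedGaloisRep K (PadicAlgCl ℓ) n), ρ.toGaloisRep.IsIrreducible → ((∀ᶠ v : IsDedekindDomain.HeightOneSpectrum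 (NumberField.RingOfIntegers K) in cofinite, ρ.IsUnramifiedAt v) ∧ ∀ (v : IsDedekindDomain.HeightOneSpectrum (NumberField.RingOfIntegers K)) (hv : ((ℓ : ℕ) : NumberField.RingOfIntegers K) ∈ v.asIdeal), (Literature.NumberTheory.PAdicHodge.fontainePstAdicCompletion v ℓ hv).IsDeRhamFramed (ρ.toLocal v)) → (∀ᶠ v : IsDedekindDomain.HeightOneSpectrum (NumberField.RingOfIntegers K) in cofinite, SatakeFrobCompatibleAt ι π.1 ρ v) → ∀ v : IsDedekindDomain.HeightOneSpectrum (NumberField.RingOfIntegers K), ((ℓ : ℕ) : NumberField.RingOfIntegers K) ∉ v.asIdeal → ¬ SatakeFrobCompatibleAt ι π.1 ρ v → LocalGlobalCompatibleAt Rec ι π.1 ρ v := by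
  sorry

namespace _Goal

/-- The statement of `stub_satakePlaces` (literally its type). [folklore] -/
def stub_satakePlaces : Prop :=
  type_of% @Summit.Langlands.Langlands.Cruxes.SectorComplement.BirthCompatibilityAwayFromLR.stub_satakePlaces

/-- The statement of `stub_exceptionalPlaces` (literally its type). [folklore] -/
def stub_exceptionalPlaces : Prop :=
  type_of% @Summit.Langlands.Langlands.Cruxes.SectorComplement.BirthCompatibilityAwayFromLR.stub_exceptionalPlaces

end _Goal

/-- **L∤R from its two stubs** (case split on `SatakeFrobCompatibleAt ι π.1 ρ v`), concluding the PrimeSwitchSplit decl BY NAME. -/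
theorem CompatibilityAwayFromLR_of (h1 : _Goal.stub_satakePlaces) (h2 : _Goal.stub_exceptionalPlaces) :
    CompatibilityAwayFromLR := by
  dsimp only [_Goal.stub_satakePlaces, _Goal.stub_exceptionalPlaces] at h1 h2
  intro K _ _ Rec n hcpt hn π hL ℓ _ ι ρ hirr hgeo hρ v hv
  by_cases hs : SatakeFrobCompatibleAt ι π.1 ρ v
  · exact h1 K Rec n hcpt hn π hL ℓ ι ρ hirr hgeo hρ v hv hs
  · exact h2 K Rec n hcpt hn π hL ℓ ι ρ hirr hgeo hρ v hv hs

/-- by-name sanity check -/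
example : CompatibilityAwayFromLR := CompatibilityAwayFromLR_of stub_satakePlaces stub_exceptionalPlaces

end Summit.Langlands.Langlands.Cruxes.SectorComplement.BirthCompatibilityAwayFromLR

end
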